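import Mathlib
import HarnessLib
import Literature.MathematicalPhysics.QuantumLattice.DWaveOrderParameterProofs
import Literature.MathematicalPhysics.QuantumLattice.TorusFermiWeightSum
import Literature.MathematicalPhysics.QuantumLattice.DWaveSourceFreeGainBound
import Summits.HubbardSuperconductivity.HubbardSuperconductivity.Theorems.WeakCouplingBCSWcbcsBcsConstructionInteractionComparison
import Summits.HubbardSuperconductivity.HubbardSuperconductivity.Theorems.WeakCouplingBCSWcbcsBcsConstructionFreeSourcedGroundEnergy

/-!
# Route `WeakCouplingBCS` — crux `WcbcsBcsConstruction` (stmt-HubbardSuperconductivity-2010),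
# line `lro-seed-kink-bridge`, stub `stub_orderParameterCeiling`

The rigorous CEILING matching the conjectured floor `e^{-C/U²} ≤ dWaveOrderParameter U μ` of the
crux: on every compact window `[μ₁, μ₂] ⊂ (-4, 0)` of chemical potentials the Koma–Tasaki `d`-wave
order parameter of the weakly repulsive Hubbard torus is `O(√U log(1/U))`,

`dWaveOrderParameter U μ ≤ C √U (1 + log(1/U))`   (`0 < U < U₁`, `μ ∈ [μ₁, μ₂]`),

i.e. every stair above `h ≈ √U` of the staircase `dWaveOrderParameter U μ = ⨅_{h>0} F(U,μ,h)` is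
free-gas physics.

Proof (folklore; Koma–Tasaki 1994, §1 for the set-up). Write `D_L(U,h) = dWaveSourceDensity L U μ h`
and `E(s) = E₀(dWaveSourceTorus L 0 μ s)` (free sourced ground energy).
* (a) free response at source `2h`: `D_L(0,2h) ≤ (E(2h) - E(4h))/(4hL²) ≤ (E(0) - E(4h))/(4hL²)`
  (`dWaveSourceDensity_le_energyDrop_div`, `groundEnergy_dWaveSourceTorus_le`); by the BdG formula
  (`stub_freeSourcedGroundEnergy`) `E(0) - E(4h) = Σ_k (√(ξ_k² + a_k²) - |ξ_k|)` with
  `a_k² = 128 h² ĝ_d(k)² ≤ 512 h²`, and per mode `√(ξ² + a²) - |ξ| ≤ (2a² + h²)/(|ξ| + 2h)`, so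
  `E(0) - E(4h) ≤ 1025 h² Σ_k 1/(|ξ_k| + 2h)`, which the torus Cooper logarithm
  (`exists_sum_fermiWeight_le` at `β = 1/h`) bounds by `1025 h² (C_F (1 + log(1/h)) L² + 8L/h)`;
* (b) interaction comparison (`stub_interactionComparison`, couplings `0 ≤ U`, shift `r = h`):
  `D_L(U,h) ≤ D_L(0,2h) + U/(2h)`;
* (c) `dWaveOrderParameter U μ ≤ liminf_L D_{L+1}(U,h)` (`dWaveOrderParameter_le_liminf`), and the
  `O(1/L)` remainder disappears in the liminf;
* (d) the choice `h = √U`.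
-/

noncomputable section

set_option linter.dupNamespace false

namespace Summit.HubbardSuperconductivity.HubbardSuperconductivity.Theorems

open Literature.MathematicalPhysics.QuantumLattice Literature.Probability.LatticeModels Matrix Filter
open scoped Matrix.Norms.L2Operator ComplexOrder Topology

/-- Per-mode BdG energy gain: `√(ξ² + a²) - |ξ| ≤ (2a² + h²)/(|ξ| + 2h)` for every `h > 0`
(it is `≤ min(|a|, a²/(2|ξ|))`). [folklore] -/
theorem sqrt_sq_add_sq_sub_abs_le (ξ a : ℝ) {h : ℝ} (hh : 0 < h) :
    Real.sqrt (ξ ^ 2 + a ^ 2) - |ξ| ≤ (2 * a ^ 2 + h ^ 2) / (|ξ| + 2 * h) := by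
  have ht : 0 ≤ |ξ| := abs_nonneg ξ
  have hS : 0 ≤ Real.sqrt (ξ ^ 2 + a ^ 2) := Real.sqrt_nonneg _
  have hS2 : Real.sqrt (ξ ^ 2 + a ^ 2) ^ 2 = |ξ| ^ 2 + a ^ 2 := by
    rw [Real.sq_sqrt (by positivity), sq_abs]
  have hSt : |ξ| ≤ Real.sqrt (ξ ^ 2 + a ^ 2) := Real.abs_le_sqrt (by nlinarith [sq_nonneg a])
  rw [le_div_iff₀ (by positivity)]
  set S := Real.sqrt (ξ ^ 2 + a ^ 2)
  set t := |ξ|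
  nlinarith [mul_nonneg hS (sub_nonneg.2 hSt), mul_nonneg ht (sub_nonneg.2 hSt),
    sq_nonneg (S - t - h)]

/-- **Free energy response to the `d`-wave source.** For the free (`U = 0`) sourced torus, `L ≥ 3`,
`h > 0`: `E(0) - E(4h) ≤ 1025 h² Σ_k (1/h)/(2 + |ξ_k|/h)` (`= 1025 h² Σ_k 1/(|ξ_k| + 2h)`),
`ξ_k = ε_L(k) - μ` — the BdG sum with `a_k² = 128h²ĝ_d(k)² ≤ 512h²` and the per-mode gain bound.
[folklore] -/
theorem free_sourced_energyGain_le (L : ℕ) [NeZero L] (hL : 3 ≤ L) (μ : ℝ) {h : ℝ} (hh : 0 < h) :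
    (dWaveSourceTorus L 0 μ 0).groundEnergy - (dWaveSourceTorus L 0 μ (2 * (2 * h))).groundEnergy ≤
      1025 * h ^ 2 * ∑ k : TorusSite 2 L, (1 / h) / (2 + (1 / h) * |torusBand L k - μ|) := by
  rw [stub_freeSourcedGroundEnergy L hL μ 0, stub_freeSourcedGroundEnergy L hL μ (2 * (2 * h)),
    ← Finset.sum_sub_distrib, Finset.mul_sum]
  refine Finset.sum_le_sum fun k _ => ?_
  simp only [mul_zero, zero_mul, ne_eq, OfNat.ofNat_ne_zero, not_false_eq_true, zero_pow, add_zero,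
    Real.sqrt_sq_eq_abs]
  set ξ := torusBand L k - μ
  set a := 2 * Real.sqrt 2 * (2 * (2 * h)) * dWaveGap k with ha_def
  have ha : a ^ 2 ≤ 512 * h ^ 2 := by
    have hg2 : (dWaveGap k) ^ 2 ≤ 2 ^ 2 := by
      rw [← sq_abs]; exact pow_le_pow_left₀ (abs_nonneg _) (abs_dWaveGap_le_two k) 2
    have : a ^ 2 = 128 * h ^ 2 * (dWaveGap k) ^ 2 := by
      rw [ha_def, mul_pow, mul_pow, mul_pow, Real.sq_sqrt zero_le_two]; ring
    rw [this]
    nlinarith [sq_nonneg h]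
  have hw : (1 / h) / (2 + (1 / h) * |ξ|) = 1 / (|ξ| + 2 * h) := by
    have h1 : |ξ| + 2 * h ≠ 0 := by positivity
    field_simp
    ring
  rw [hw]
  calc ξ - |ξ| - (ξ - Real.sqrt (ξ ^ 2 + a ^ 2)) = Real.sqrt (ξ ^ 2 + a ^ 2) - |ξ| := by ring
    _ ≤ (2 * a ^ 2 + h ^ 2) / (|ξ| + 2 * h) := sqrt_sq_add_sq_sub_abs_le ξ a hh
    _ ≤ (1025 * h ^ 2) / (|ξ| + 2 * h) := div_le_div_of_nonneg_right (by nlinarith) (by positivity)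
    _ = 1025 * h ^ 2 * (1 / (|ξ| + 2 * h)) := by ring

/-- **Finite-volume ceiling.** For `L ≥ 3`, `0 ≤ U`, `h > 0` and a torus Cooper-logarithm bound
`Σ_k (1/h)/(2 + |ξ_k|/h) ≤ C_F (1 + log(1/h)) L² + 8L/h` at this `μ`:
`D_L(U,h) ≤ (1025/4) C_F h (1 + log(1/h)) + 2050/L + U/(2h)` — interaction comparison down to `U = 0`
at source `2h`, then the free response. [cite: KomaTasaki1994, §1] -/
theorem dWaveSourceDensity_le_free_ceiling {C_F μ h U : ℝ} (hh : 0 < h) (hU : 0 ≤ U)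
    (hFW : ∀ (L : ℕ) [NeZero L],
      ∑ k : TorusSite 2 L, (1 / h) / (2 + (1 / h) * |torusBand L k - μ|) ≤
        C_F * (1 + Real.log (1 / h)) * (L : ℝ) ^ 2 + 8 * (1 / h) * L)
    (L : ℕ) [NeZero L] (hL : 3 ≤ L) :
    dWaveSourceDensity L U μ h ≤
      1025 / 4 * C_F * h * (1 + Real.log (1 / h)) + 2050 / (L : ℝ) + U / (2 * h) := by
  -- (b) interaction comparison between couplings `0 ≤ U` with shift `r = h`
  have hS2 := (stub_interactionComparison L 0 U μ h h hU hh).2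
  rw [sub_zero, ← two_mul] at hS2
  -- (a) free response at source `2h`
  have h2h : 0 < 2 * h := by positivity
  have hfree := dWaveSourceDensity_le_energyDrop_div (L := L) 0 μ h2h
  have hE0 := groundEnergy_dWaveSourceTorus_le (L := L) 0 μ (2 * h)
  have hgain := free_sourced_energyGain_le L hL μ hh
  have hsum := mul_le_mul_of_nonneg_left (hFW L) (by positivity : (0 : ℝ) ≤ 1025 * h ^ 2)
  have hL0 : (0 : ℝ) < L := by exact_mod_cast Nat.pos_of_ne_zero (NeZero.ne L)
  have hden : 0 < 2 * (2 * h) * (L : ℝ) ^ 2 := by positivity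
  have hdrop : ((dWaveSourceTorus L 0 μ (2 * h)).groundEnergy -
      (dWaveSourceTorus L 0 μ (2 * (2 * h))).groundEnergy) / (2 * (2 * h) * (L : ℝ) ^ 2) ≤
        1025 / 4 * C_F * h * (1 + Real.log (1 / h)) + 2050 / (L : ℝ) := by
    rw [div_le_iff₀ hden]
    have eq : (1025 / 4 * C_F * h * (1 + Real.log (1 / h)) + 2050 / (L : ℝ)) *
        (2 * (2 * h) * (L : ℝ) ^ 2) =
          1025 * h ^ 2 * (C_F * (1 + Real.log (1 / h)) * (L : ℝ) ^ 2 + 8 * (1 / h) * L) := by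
      field_simp
      ring
    rw [eq]
    linarith
  linarith

/-- **Stub `stub_orderParameterCeiling`** of the line `lro-seed-kink-bridge` (crux
`WcbcsBcsConstruction`): on every compact window `[μ₁, μ₂] ⊂ (-4, 0)` there are `C > 0` and `U₁ > 0`
with `dWaveOrderParameter U μ ≤ C √U (1 + log(1/U))` for all `U ∈ (0, U₁)`, `μ ∈ [μ₁, μ₂]` — the
Koma–Tasaki `d`-wave order parameter of the weakly repulsive Hubbard torus is `O(√U log(1/U))`
(free BdG response + torus Cooper logarithm at the stair `h = √U`, interaction comparison, and
`dWaveOrderParameter ≤` every stair). [cite: KomaTasaki1994, §1] -/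
theorem stub_orderParameterCeiling :
    ∀ μ₁ μ₂ : ℝ, -4 < μ₁ → μ₁ ≤ μ₂ → μ₂ < 0 → ∃ C : ℝ, 0 < C ∧ ∃ U₁ : ℝ, 0 < U₁ ∧
      ∀ U ∈ Set.Ioo 0 U₁, ∀ μ ∈ Set.Icc μ₁ μ₂,
        dWaveOrderParameter U μ ≤ C * Real.sqrt U * (1 + Real.log (1 / U)) := by
  intro μ₁ μ₂ h4 _h12 h0
  set d₀ := min (μ₁ + 4) (-μ₂) with hd₀def
  have hd₀ : 0 < d₀ := lt_min (by linarith) (by linarith)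
  obtain ⟨C_F, hC_F, hFW⟩ := exists_sum_fermiWeight_le hd₀
  refine ⟨1025 / 4 * C_F + 1, by positivity, 1, one_pos, ?_⟩
  intro U hU μ hμ
  have hU0 : 0 < U := hU.1
  have hU1 : U < 1 := hU.2
  have hμ4 : d₀ ≤ μ + 4 := (min_le_left _ _).trans (by linarith [hμ.1])
  have hμ0 : d₀ ≤ -μ := (min_le_right _ _).trans (by linarith [hμ.2])
  set r := Real.sqrt U with hr
  have hr0 : 0 < r := Real.sqrt_pos.2 hU0
  have hr1 : r < 1 := by
    have := Real.sqrt_lt_sqrt hU0.le hU1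
    rwa [Real.sqrt_one] at this
  have hβ : 1 ≤ 1 / r := by rw [le_div_iff₀ hr0]; linarith
  -- (c) the stair `h = r`: `dWaveOrderParameter ≤ liminf_L D_{L+1}(U,r) ≤ (1025/4) C_F r (1 + log(1/r)) + U/(2r)`
  have hstair : dWaveOrderParameter U μ ≤
      1025 / 4 * C_F * r * (1 + Real.log (1 / r)) + U / (2 * r) := by
    refine (dWaveOrderParameter_le_liminf U μ hr0).trans ?_
    refine le_of_forall_pos_le_add fun ε hε => ?_
    refine liminf_le_of_frequently_le (Eventually.frequently ?_)
      (isBoundedUnder_of_eventually_ge (a := 0)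
        (Eventually.of_forall fun L => dWaveSourceDensity_nonneg U μ hr0.le))
    obtain ⟨N, hN⟩ := exists_nat_gt (2050 / ε)
    filter_upwards [eventually_ge_atTop (max N 2)] with L hL
    have hNL : N ≤ L := le_of_max_le_left hL
    have h2L : 2 ≤ L := le_of_max_le_right hL
    have hL3 : 3 ≤ L + 1 := by omega
    have hLpos : (0 : ℝ) < ((L + 1 : ℕ) : ℝ) := by positivity
    have hcast : (2050 / ε : ℝ) < ((L + 1 : ℕ) : ℝ) :=
      hN.trans_le (by exact_mod_cast Nat.le_succ_of_le hNL)
    have hrem : 2050 / ((L + 1 : ℕ) : ℝ) ≤ ε := by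
      rw [div_le_iff₀ hLpos]
      rw [div_lt_iff₀ hε] at hcast
      linarith
    have hfin := dWaveSourceDensity_le_free_ceiling hr0 hU0.le (hFW μ hμ4 hμ0 (1 / r) hβ) (L + 1) hL3
    linarith
  -- (d) `h = √U`: `log(1/√U) = log(1/U)/2`, `U/(2√U) = √U/2`
  have hlog : Real.log (1 / r) = Real.log (1 / U) / 2 := by
    rw [one_div, Real.log_inv, one_div, Real.log_inv, hr, Real.log_sqrt hU0.le]
    ring
  have hUr : U / (2 * r) = r / 2 := by
    have hUrr : U = r * r := (Real.mul_self_sqrt hU0.le).symm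
    rw [hUrr]
    field_simp
  have hℓ : 0 ≤ Real.log (1 / U) := Real.log_nonneg (by rw [le_div_iff₀ hU0]; linarith)
  calc dWaveOrderParameter U μ
      ≤ 1025 / 4 * C_F * r * (1 + Real.log (1 / r)) + U / (2 * r) := hstair
    _ = 1025 / 4 * C_F * r * (1 + Real.log (1 / U) / 2) + r / 2 := by rw [hlog, hUr]
    _ ≤ (1025 / 4 * C_F + 1) * r * (1 + Real.log (1 / U)) := by
        nlinarith [mul_nonneg (mul_nonneg hC_F.le hr0.le) hℓ, mul_nonneg hr0.le hℓ]

end Summit.HubbardSuperconductivity.HubbardSuperconductivity.Theorems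

end
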